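import Literature.AlgebraicGeometry.HodgeTheory.AbelianVarietySubvarietyIsotypicPieces
import Literature.AlgebraicGeometry.HodgeTheory.AbelianVarietyIsotypicComponentsEndomorphismRing
import HarnessLib

/-!
# The endomorphism algebra of an abelian subvariety, of a finite cover and of a quotient along the isotypic
# decomposition of `X`: `End⁰(Z) ≃ ∏_q End⁰(Z_q) ≃ ∏_q M_{s_q}(End⁰ B_q)` with `s_q ≤ n_q + 1`, hence
# `[End⁰(Z) : ℚ] = Σ_q s_q² [End⁰(B_q) : ℚ] ≤ [End⁰(X) : ℚ]` (Mumford §19 Cor. 1–2; Milne 1986 §12 Prop. 12.1)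

Layer `Literature/AlgebraicGeometry/HodgeTheory`; theorems only (no `def`, no instance, no named fact; net debt 0).  Sequel of
`…SubvarietyIsotypicPieces` (the pieces `Z_q = u_q(Z)` of an abelian subvariety `j : Z ↪ X`, `Hom`-orthogonal with
addition map `⨁_q Z_q → Z` an isogeny) and `…IsotypicComponentsEndomorphismRing` (`End⁰` along a `Hom`-orthogonal system,
`End⁰(Y) ≃ₐ M_m(End⁰ B)` for `Y ∼ B^m`, Mumford §19 Cor. 2 for `X`).  §1 holds over ANY field in the setting of
`…SubvarietyIsotypicPieces` §1; §2 is over a PERFECT field for the isotypic components `Y_q ∼ B_q^{n_q+1}` of `X`, and §3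
for an ARBITRARY `X` over a perfect field (its isotypic components exist: `exists_isotypicComponents_orthogonal`).

THE PRINT.  Mumford, *Abelian Varieties* §19 Cor. 1 (p. 173: `X ∼ ∏ X_i^{n_i}`, unique) and Cor. 2 (p. 174: «`End⁰(X) =
⊕_i M_{n_i}(D_i)`, `D_i = End⁰(X_i)`»); Milne 1986 §12 Prop. 12.1 and p. 122 (PDF p. 189: the same, the `r_i` uniquely
determined); applied to an abelian subvariety `Z ↪ X`, whose simple types are among the `B_q` with multiplicities
`s_q ≤ n_q + 1` (`…SubvarietyIsotypicPieces.exists_isotypicPieces_of_isClosedImmersion`), to a finite cover `Z → X`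
(`Z ∼ im`, Mumford §19 Thm. 1) and to a quotient `X ↠ Z` (a quasi-section, Milne Prop. 12.1's proof; Mumford §19 Remark
p. 169); `End⁰` is an isogeny invariant (`Motives.AbelianVariety.IsIsogenous.nonempty_endAlgebra_algEquiv`).

Results (namespace `Literature.AlgebraicGeometry.HodgeTheory.AbelianVariety`):
* §1 (any field) `nonempty_algEquiv_endAlgebra_pi_isotypicPieces` (`End⁰(Z) ≃ₐ[ℚ] ∏_q End⁰(Z_q)`),
  `finrank_endAlgebra_eq_sum_isotypicPieces`;
* §2 (perfect field, components of `X` given) **`exists_algEquiv_endAlgebra_pi_matrix_of_isClosedImmersion`**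
  (`End⁰(Z) ≃ₐ[ℚ] ∏_q M_{s_q}(End⁰ B_q)`, `s_q ≤ n_q + 1`), `exists_finrank_endAlgebra_eq_sum_sq_mul_of_isClosedImmersion`,
  **`finrank_endAlgebra_le_of_isClosedImmersion_of_isotypicComponents`** (`[End⁰ Z : ℚ] ≤ [End⁰ X : ℚ]`), and the same for a
  FINITE `f : Z → X` (`…_of_isFinite`) and a SURJECTIVE `f : X ↠ Z` (`…_of_surjective`);
* §3 (perfect field, every `X`) **`finrank_endAlgebra_le_of_isClosedImmersion`**, `finrank_endAlgebra_le_of_isFinite`,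
  `finrank_endAlgebra_le_of_surjective`, `finrank_endAlgebra_image_le_source` ∕ `_le_target` (`[End⁰(im f) : ℚ]` is bounded by
  both `[End⁰ Z : ℚ]` and `[End⁰ X : ℚ]` for every `f : Z → X`).

## References
* [MumfordAV1970] D. Mumford, *Abelian Varieties* (1970), §19 Thm. 1, Remark p. 169, Cor. 1–2 (pp. 169–174).
* [Milne1986AbelianVarieties] J. S. Milne, *Abelian Varieties*, in Cornell–Silverman (1986), §12 Prop. 12.1 and p. 122 (PDF p. 189).
* [SilverbergZarhin2015] A. Silverberg, Yu. G. Zarhin, *Isogenies of abelian varieties over finite fields* (2015) (arXiv:1409.0592),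
  proof of Lemma 3.3 (p. 5: `End⁰_F(A) ≅ ⊕ End⁰_F(X)`).
* [Shimura1998] G. Shimura, *Abelian Varieties with Complex Multiplication and Modular Functions* (1998), §5.1 (proof of Prop. 3).
-/

noncomputable section

universe u

open CategoryTheory CategoryTheory.Limits

namespace Literature.AlgebraicGeometry.HodgeTheory

namespace AbelianVariety

open _root_.AlgebraicGeometry
open Literature.AlgebraicGeometry.Motives Literature.AlgebraicGeometry.Motives.AbelianVariety

variable {K : Type u} [Field K]

/-! ## §1 `End⁰(Z)` along the isotypic pieces (any field) -/

section AnyField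

variable {Q : Type} [Fintype Q] {X Z : Motives.AbelianVariety K} {Y : Q → Motives.AbelianVariety K} (i : ∀ q, Y q ⟶ X)
  {v : X ⟶ ⨁ Y} {m : ℕ} (j : Z ⟶ X)

/-- **`End⁰(Z) ≃ₐ[ℚ] ∏_q End⁰(Z_q)` along the isotypic pieces of an abelian subvariety** (any field; `Hom`-orthogonal system
`i_q : Y_q ↪ X` with quasi-inverse, `j : Z ↪ X` with a quasi-retraction, pieces `a_q : Z_q ↪ Z`, `b_q : Z_q ↪ Y_q`): the
pieces are `Hom`-orthogonal abelian subvarieties of `Z` whose addition map is an isogeny. [cite: MumfordAV1970, §19 Cor. 2 of Thm. 1 (p. 174)]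
[cite: SilverbergZarhin2015, proof of Lemma 3.3 (p. 5)] -/
theorem nonempty_algEquiv_endAlgebra_pi_isotypicPieces (hi : ∀ q, IsClosedImmersion (Hom.toSchemeHom (i q)))
    (hdesc : IsIsogeny (biproduct.desc i)) (hdv : biproduct.desc i ≫ v = m • 𝟙 (⨁ Y))
    (hvd : v ≫ biproduct.desc i = m • 𝟙 X) (horth : ∀ q q', q ≠ q' → ∀ f : Y q ⟶ Y q', f = 0) (hm : m ≠ 0)
    [IsClosedImmersion (Hom.toSchemeHom j)] {h : X ⟶ Z} {N : ℕ} (hN : N ≠ 0) (hjh : j ≫ h = N • 𝟙 Z)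
    (a : ∀ q, image (j ≫ (v ≫ biproduct.π Y q) ≫ i q) ⟶ Z) (ha : ∀ q, a q ≫ j = imageι (j ≫ (v ≫ biproduct.π Y q) ≫ i q))
    (b : ∀ q, image (j ≫ (v ≫ biproduct.π Y q) ≫ i q) ⟶ Y q)
    (hb : ∀ q, b q ≫ i q = imageι (j ≫ (v ≫ biproduct.π Y q) ≫ i q)) (hbci : ∀ q, IsClosedImmersion (Hom.toSchemeHom (b q))) :
    Nonempty (Z.endAlgebra ≃ₐ[ℚ] ∀ q, (image (j ≫ (v ≫ biproduct.π Y q) ≫ i q)).endAlgebra) :=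
  nonempty_algEquiv_endAlgebra_pi_components a (fun q ↦ isClosedImmersion_of_comp_eq_of_isClosedImmersion _ j (a q) (ha q))
    (isIsogeny_biproduct_desc_isotypicPieces i j hdesc hm hvd a ha b hb hbci)
    fun _ _ hqq' f ↦ hom_isotypicPieces_eq_zero i j hi hdesc hdv horth hm hN hjh a ha b hb hqq' f

/-- `[End⁰ Z : ℚ] = Σ_q [End⁰ Z_q : ℚ]` along the isotypic pieces (any field). [cite: MumfordAV1970, §19 Cor. 2 of Thm. 1 (p. 174)]
[cite: Milne1986AbelianVarieties, §12 p. 122 (PDF p. 189)] -/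
theorem finrank_endAlgebra_eq_sum_isotypicPieces (hi : ∀ q, IsClosedImmersion (Hom.toSchemeHom (i q)))
    (hdesc : IsIsogeny (biproduct.desc i)) (hdv : biproduct.desc i ≫ v = m • 𝟙 (⨁ Y))
    (hvd : v ≫ biproduct.desc i = m • 𝟙 X) (horth : ∀ q q', q ≠ q' → ∀ f : Y q ⟶ Y q', f = 0) (hm : m ≠ 0)
    [IsClosedImmersion (Hom.toSchemeHom j)] {h : X ⟶ Z} {N : ℕ} (hN : N ≠ 0) (hjh : j ≫ h = N • 𝟙 Z)
    (a : ∀ q, image (j ≫ (v ≫ biproduct.π Y q) ≫ i q) ⟶ Z) (ha : ∀ q, a q ≫ j = imageι (j ≫ (v ≫ biproduct.π Y q) ≫ i q))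
    (b : ∀ q, image (j ≫ (v ≫ biproduct.π Y q) ≫ i q) ⟶ Y q)
    (hb : ∀ q, b q ≫ i q = imageι (j ≫ (v ≫ biproduct.π Y q) ≫ i q)) (hbci : ∀ q, IsClosedImmersion (Hom.toSchemeHom (b q))) :
    Module.finrank ℚ Z.endAlgebra = ∑ q, Module.finrank ℚ (image (j ≫ (v ≫ biproduct.π Y q) ≫ i q)).endAlgebra :=
  finrank_endAlgebra_eq_sum_components a (fun q ↦ isClosedImmersion_of_comp_eq_of_isClosedImmersion _ j (a q) (ha q))
    (isIsogeny_biproduct_desc_isotypicPieces i j hdesc hm hvd a ha b hb hbci)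
    fun _ _ hqq' f ↦ hom_isotypicPieces_eq_zero i j hi hdesc hdv horth hm hN hjh a ha b hb hqq' f

end AnyField

/-! ## §2 Over a perfect field, along the isotypic components of `X` -/

section Perfect

variable [PerfectField K] {Q : Type} [Fintype Q] {B : Q → Motives.AbelianVariety K} {n : Q → ℕ}
  {X Z : Motives.AbelianVariety K} {Y : Q → Motives.AbelianVariety K}

/-- **`End⁰(Z) ≃ₐ[ℚ] ∏_q M_{s_q}(End⁰ B_q)` with `s_q ≤ n_q + 1` for every abelian subvariety `Z ↪ X`** (perfect field;
isotypic components `Y_q ∼ B_q^{n_q+1}` of `X`, `B_q` simple of positive dimension, pairwise non-isogenous; `s_q = 0` gives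
the zero ring `M_0`). [cite: MumfordAV1970, §19 Cor. 1–2 of Thm. 1 (pp. 173–174)] [cite: Milne1986AbelianVarieties, §12 Prop. 12.1 and p. 122 (PDF p. 189)] -/
theorem exists_algEquiv_endAlgebra_pi_matrix_of_isClosedImmersion (hB : ∀ q, (B q).IsSimple) (hB0 : ∀ q, 0 < (B q).dim)
    (hni : ∀ q q', q ≠ q' → ¬ IsIsogenous (B q) (B q'))
    (hY : ∀ q, IsIsogenous (Y q) (⨁ fun _ : Fin (n q + 1) ↦ B q)) (i : ∀ q, Y q ⟶ X)
    (hi : ∀ q, IsClosedImmersion (Hom.toSchemeHom (i q))) (hdesc : IsIsogeny (biproduct.desc i))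
    (j : Z ⟶ X) [IsClosedImmersion (Hom.toSchemeHom j)] :
    ∃ s : Q → ℕ, (∀ q, s q ≤ n q + 1) ∧
      Nonempty (Z.endAlgebra ≃ₐ[ℚ] ∀ q, Matrix (Fin (s q)) (Fin (s q)) (B q).endAlgebra) := by
  classical
  obtain ⟨W, a, -, haci, -, -, hda, hs, horth⟩ := exists_isotypicPieces_of_isClosedImmersion hB hB0 hni hY i hi hdesc j
  choose s hs hW using hs
  obtain ⟨e₁⟩ := nonempty_algEquiv_endAlgebra_pi_components a haci hda horth
  have e₂ : ∀ q, (W q).endAlgebra ≃ₐ[ℚ] Matrix (Fin (s q)) (Fin (s q)) (B q).endAlgebra :=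
    fun q ↦ Classical.choice (nonempty_algEquiv_endAlgebra_matrix_of_isIsogenous_biproduct_const (hW q))
  exact ⟨s, hs, ⟨e₁.trans (AlgEquiv.piCongrRight e₂)⟩⟩

/-- `[End⁰ Z : ℚ] = Σ_q s_q² · [End⁰ B_q : ℚ]` with `s_q ≤ n_q + 1`, for every abelian subvariety `Z ↪ X` (perfect field).
[cite: MumfordAV1970, §19 Cor. 2 of Thm. 1 (p. 174)] [cite: Milne1986AbelianVarieties, §12 p. 122 (PDF p. 189)] -/
theorem exists_finrank_endAlgebra_eq_sum_sq_mul_of_isClosedImmersion (hB : ∀ q, (B q).IsSimple)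
    (hB0 : ∀ q, 0 < (B q).dim) (hni : ∀ q q', q ≠ q' → ¬ IsIsogenous (B q) (B q'))
    (hY : ∀ q, IsIsogenous (Y q) (⨁ fun _ : Fin (n q + 1) ↦ B q)) (i : ∀ q, Y q ⟶ X)
    (hi : ∀ q, IsClosedImmersion (Hom.toSchemeHom (i q))) (hdesc : IsIsogeny (biproduct.desc i))
    (j : Z ⟶ X) [IsClosedImmersion (Hom.toSchemeHom j)] :
    ∃ s : Q → ℕ, (∀ q, s q ≤ n q + 1) ∧
      Module.finrank ℚ Z.endAlgebra = ∑ q, s q ^ 2 * Module.finrank ℚ (B q).endAlgebra := by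
  classical
  obtain ⟨s, hs, ⟨e⟩⟩ := exists_algEquiv_endAlgebra_pi_matrix_of_isClosedImmersion hB hB0 hni hY i hi hdesc j
  haveI : ∀ q, Module.Finite ℚ (B q).endAlgebra := fun q ↦ finiteDimensional_endAlgebra_holds (B q)
  haveI : ∀ q, Module.Free ℚ (B q).endAlgebra := fun q ↦
    @Module.Free.of_divisionRing ℚ (B q).endAlgebra _ Ring.toAddCommGroup Algebra.toModule
  refine ⟨s, hs, ?_⟩
  rw [e.toLinearEquiv.finrank_eq, Module.finrank_pi_fintype]
  exact Finset.sum_congr rfl fun q _ ↦ by rw [Module.finrank_matrix, Fintype.card_fin, sq]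

/-- **`[End⁰ Z : ℚ] ≤ [End⁰ X : ℚ]` for every abelian subvariety `Z ↪ X`** (perfect field; along given isotypic components
of `X`: `Σ s_q² d_q ≤ Σ (n_q+1)² d_q`). [cite: MumfordAV1970, §19 Cor. 1–2 of Thm. 1 (pp. 173–174)]
[cite: Milne1986AbelianVarieties, §12 Prop. 12.1 and p. 122 (PDF p. 189)] -/
theorem finrank_endAlgebra_le_of_isClosedImmersion_of_isotypicComponents (hB : ∀ q, (B q).IsSimple)
    (hB0 : ∀ q, 0 < (B q).dim) (hni : ∀ q q', q ≠ q' → ¬ IsIsogenous (B q) (B q'))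
    (hY : ∀ q, IsIsogenous (Y q) (⨁ fun _ : Fin (n q + 1) ↦ B q)) (i : ∀ q, Y q ⟶ X)
    (hi : ∀ q, IsClosedImmersion (Hom.toSchemeHom (i q))) (hdesc : IsIsogeny (biproduct.desc i))
    (j : Z ⟶ X) [IsClosedImmersion (Hom.toSchemeHom j)] :
    Module.finrank ℚ Z.endAlgebra ≤ Module.finrank ℚ X.endAlgebra := by
  obtain ⟨s, hs, hZ⟩ := exists_finrank_endAlgebra_eq_sum_sq_mul_of_isClosedImmersion hB hB0 hni hY i hi hdesc j
  rw [hZ, finrank_endAlgebra_eq_sum_sq_mul hB hB0 hni hY i hi hdesc]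
  exact Finset.sum_le_sum fun q _ ↦ Nat.mul_le_mul_right _ (Nat.pow_le_pow_left (hs q) 2)

end Perfect

/-! ## §3 Over a perfect field, for every `X`: subvarieties, finite covers, quotients, images -/

section Every

variable [PerfectField K] {X Z : Motives.AbelianVariety K}

/-- **`[End⁰ Z : ℚ] ≤ [End⁰ X : ℚ]` FOR EVERY ABELIAN SUBVARIETY `Z ↪ X`** over a perfect field (isotypic components of
`X` exist: `exists_isotypicComponents_orthogonal`). [cite: MumfordAV1970, §19 Cor. 1–2 of Thm. 1 (pp. 173–174)]
[cite: Milne1986AbelianVarieties, §12 Prop. 12.1 and p. 122 (PDF p. 189)] -/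
theorem finrank_endAlgebra_le_of_isClosedImmersion (j : Z ⟶ X) [IsClosedImmersion (Hom.toSchemeHom j)] :
    Module.finrank ℚ Z.endAlgebra ≤ Module.finrank ℚ X.endAlgebra := by
  obtain ⟨r, B, n, Y, i, hB, hB0, hni, hi, hY, -, hdesc, -⟩ := exists_isotypicComponents_orthogonal X
  exact finrank_endAlgebra_le_of_isClosedImmersion_of_isotypicComponents hB hB0 hni hY i hi hdesc j

/-- `[End⁰ Z : ℚ] ≤ [End⁰ X : ℚ]` for every FINITE homomorphism `f : Z → X` (e.g. an isogeny onto an abelian subvariety):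
`Z ∼ im f ↪ X` and `End⁰` is an isogeny invariant. [cite: MumfordAV1970, §19 Thm. 1, Remark p. 169 and Cor. 2 (pp. 169–174)]
[cite: Milne1986AbelianVarieties, §12 p. 122 (PDF p. 189)] -/
theorem finrank_endAlgebra_le_of_isFinite (f : Z ⟶ X) [IsFinite (Hom.toSchemeHom f)] :
    Module.finrank ℚ Z.endAlgebra ≤ Module.finrank ℚ X.endAlgebra := by
  rw [(isIsogenous_image_of_isFinite f).finrank_endAlgebra_eq]
  exact finrank_endAlgebra_le_of_isClosedImmersion (imageι f)

/-- `[End⁰ Z : ℚ] ≤ [End⁰ X : ℚ]` for every QUOTIENT `f : X ↠ Z` (perfect field: a quasi-section `t : Z → X`,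
`t ≫ f = N • 𝟙`, is finite). [cite: Milne1986AbelianVarieties, §12 Prop. 12.1 and its proof (PDF p. 189)]
[cite: MumfordAV1970, §19 Thm. 1 and Remark p. 169] -/
theorem finrank_endAlgebra_le_of_surjective (f : X ⟶ Z) [Surjective (Hom.toSchemeHom f)] :
    Module.finrank ℚ Z.endAlgebra ≤ Module.finrank ℚ X.endAlgebra := by
  obtain ⟨t, N, hN, ht⟩ := exists_quasiSection_of_perfectField f
  haveI := isFinite_of_comp_eq_nsmul_id hN ht
  exact finrank_endAlgebra_le_of_isFinite t

/-- `[End⁰(im f) : ℚ] ≤ [End⁰ Z : ℚ]` for every homomorphism `f : Z → X` (`im f` is a quotient of `Z`).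
[cite: Milne1986AbelianVarieties, §12 Prop. 12.1 (PDF p. 189)] [cite: MumfordAV1970, §19 Thm. 1 (p. 173)] -/
theorem finrank_endAlgebra_image_le_source (f : Z ⟶ X) :
    Module.finrank ℚ (image f).endAlgebra ≤ Module.finrank ℚ Z.endAlgebra :=
  finrank_endAlgebra_le_of_surjective (toImage f)

/-- `[End⁰(im f) : ℚ] ≤ [End⁰ X : ℚ]` for every homomorphism `f : Z → X` (`im f ↪ X` is an abelian subvariety).
[cite: MumfordAV1970, §19 Thm. 1 and Cor. 2 (pp. 173–174)] [cite: Milne1986AbelianVarieties, §12 p. 122 (PDF p. 189)] -/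
theorem finrank_endAlgebra_image_le_target (f : Z ⟶ X) :
    Module.finrank ℚ (image f).endAlgebra ≤ Module.finrank ℚ X.endAlgebra :=
  finrank_endAlgebra_le_of_isClosedImmersion (imageι f)

end Every

end AbelianVariety

end Literature.AlgebraicGeometry.HodgeTheory

end
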